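import Literature.MathematicalPhysics.QuantumLattice.FermionEntropyChainRule
import HarnessLib

/-!
# Box subadditivity of the entropy for even lattice-fermion states, with Klein witnesses:
# `S(ρ_Ω) ≤ Σ_v S_ρ(B_v) + (|Ω| − Σ_v |B_v|)·log 4 ≤ Σ_v [Re tr(ρ Γ G_v) + log Tr e^{−G_v}] + …`

Topic `MathematicalPhysics/QuantumLattice`, namespace `Literature.MathematicalPhysics.QuantumLattice`.
Companion of `FermionEntropyChainRule.lean` (chain rule + SSA for even states: the CONDITIONAL-entropy /
window bound `vonNeumannEntropy_le_of_window_entropies`). This file records the UNCONDITIONAL box form that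
the «entropy rows» of the thermal-SDP producers use (hubbard-thermal, row families `ent` / `ent-gauss`:
`S(ρ_L) ≤ (L²/|B|)·S(ρ_B)` for a box `B` tiling the torus, then Klein's inequality per box):

* §1 bookkeeping: marginal of a marginal (`regionEntropy_fermionPartialTrace`), the corner of
  `Ω_{≤x}` (`sitesBelowEq_erase`).
* §2 `sum_entropyIncrement_le_regionEntropy` — for a sub-region `S ⊆ Ω` and an even density matrix
  `ρ ∈ 𝔄_Ω`: the increments of `Ω`'s chain at the sites of `S` are dominated by `S`'s own chain,
  `Σ_{x ∈ S} [S_ρ(Ω_{≤x}) − S_ρ(Ω_{<x})] ≤ Σ_{x ∈ S} [S_ρ(S_{≤x}) − S_ρ(S_{<x})] = S_ρ(S)` (SSA: conditioning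
  on a larger past lowers the conditional entropy; `entropyIncrement_corner_le` with window `S_{≤x}`).
* §3 `vonNeumannEntropy_le_sum_regionEntropy_add` — for pairwise DISJOINT sub-regions `B_v ⊆ Ω`
  (`v ∈ V`): `S(ρ) ≤ Σ_v S_ρ(B_v) + (|Ω| − Σ_v |B_v|)·log 4` (the remaining sites cost `≤ log 4` each,
  `entropyIncrement_le_log_four`). For the translates of one box `B` tiling `Ω` up to a seam this is
  `S(ρ) ≤ N_boxes · S_ρ(B) + seam·log 4` once the box entropies agree (translation invariance).
* §4 `regionEntropy_le_re_trace_mul_add_log_partitionFn` — KLEIN / Gibbs variational principle for a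
  marginal, in big-space form: for every Hermitian `G ∈ 𝔄_S`,
  `S_ρ(S) ≤ Re tr(Γ_{S⊆Ω}(G) ρ) + log Re Tr e^{−G}` (`vonNeumannEntropy_sub_mul_le_log_partitionFn` at
  `β = 1` for the marginal + duality `tr(G · tr_S ρ) = tr(Γ G · ρ)`). No rank condition on the marginal.
* §5 `vonNeumannEntropy_le_sum_re_trace_add` — §3 + §4 with one witness `G_v` per box:
  `S(ρ) ≤ Σ_v [Re tr(Γ(G_v) ρ) + log Re Tr e^{−G_v}] + (|Ω| − Σ_v |B_v|)·log 4` — LINEAR in `ρ`: the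
  entropy side of a finite-volume «entropy row» (with `E_β − T·S(ρ_β) ≤ E₀` for the Gibbs state it gives
  `E_β − T·Σ_v[⟨Γ G_v⟩ + log Tr e^{−G_v}] − T·seam·log 4 ≤ E₀`).

Everything is PROVED; no definition, no named fact. Not here: the identification of a translation-invariant
torus state's box marginals (equal entropies / equal witnesses' expectations) and the torus pull-back — the
thermodynamic assembly lives with the Gibbs-state files.

## References

* H. Araki, H. Moriya, Rev. Math. Phys. 15 (2003) 93, Theorem 3.8 and §10 (SSA for even states of the
  Fermion algebra; subadditivity). [cite: ArakiMoriya2003, Theorem 3.8 and §10]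
* M. A. Nielsen, I. L. Chuang, *QCQI* (2010), Thm. 11.8 (2) (`S ≤ log dim`), §11.3.4 (subadditivity),
  Thm. 11.16. [cite: NielsenChuang2010, §11.3.4]
* R. B. Israel, *Convexity in the Theory of Lattice Gases* (1979), Lemma II.3.1 (finite-volume variational
  principle). [cite: Israel1979, Lemma II.3.1]

## Tree / Mathlib

REUSED: `regionEntropy`, `entropyIncrement`, `sum_entropyIncrement`, `entropyIncrement_corner_le`,
`entropyIncrement_le_log_four` (`FermionEntropyChainRule`), `fermionPartialTrace_trans`,
`trace_fermionPartialTrace`, `posSemidef_fermionPartialTrace`, `isHermitian_fermionPartialTrace`,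
`trace_mul_fermionPartialTrace` (`FermionPartialTrace`), `PolySite.incl_trans`,
`Matrix.IsHermitian.vonNeumannEntropy_sub_mul_le_log_partitionFn` (`GibbsVariationalPrinciple`), Mathlib
`Finset.sum_biUnion`, `Finset.card_biUnion`, `Finset.sum_sdiff`. `lean search 'regionEntropy.*sum|box.*entropy'`:
only the window form (2026-08-27).
-/

noncomputable section

namespace Literature.MathematicalPhysics.QuantumLattice

open Matrix Finset HubbardWave0 Literature.Probability.LatticeModels
open scoped ComplexOrder
open Literature.InformationTheory.Entropy (vonNeumannEntropy vonNeumannEntropy_eq sum_eigenvalues_eq_one)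

variable {d : ℕ}

/-! ### §1. Bookkeeping -/

/-- **Marginal of a marginal**: for `S ⊆ Ω' ⊆ Ω`, the region entropy of `S` computed from the marginal of
`ρ` on `Ω'` is the region entropy of `S` computed from `ρ` (`tr_{Ω'∖S} ∘ tr_{Ω∖Ω'} = tr_{Ω∖S}`,
`fermionPartialTrace_trans`). [cite: ArakiMoriya2003, §3.1] -/
theorem regionEntropy_fermionPartialTrace {Ω Ω' : Finset (Site d)} (h' : Ω' ⊆ Ω) (ρ : FermionOp Ω)
    {S : Finset (Site d)} (hS : S ⊆ Ω') :
    regionEntropy (fermionPartialTrace (PolySite.incl h') ρ) S = regionEntropy ρ S := by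
  rw [regionEntropy_of_subset _ hS, regionEntropy_of_subset _ (hS.trans h'), ← fermionPartialTrace_trans,
    PolySite.incl_trans]

/-- Translation by `0` is the identity on regions. [folklore] -/
private theorem shiftSet_zero' (A : Finset (Site d)) : shiftSet (0 : Site d) A = A := by
  ext y
  simp [mem_shiftSet]

/-- Removing the corner: `Ω_{≤y} ∖ {y} = Ω_{<y}`. [folklore] -/
private theorem sitesBelowEq_erase (S : Finset (Site d)) (y : Site d) :
    (sitesBelowEq S (toLex y)).erase y = sitesBelow S (toLex y) := by
  ext z
  simp only [Finset.mem_erase, mem_sitesBelowEq, mem_sitesBelow]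
  constructor
  · rintro ⟨hne, hz, hle⟩
    exact ⟨hz, lt_of_le_of_ne hle fun h => hne (toLex_inj.1 h)⟩
  · rintro ⟨hz, hlt⟩
    refine ⟨fun h => ?_, hz, hlt.le⟩
    rw [h] at hlt
    exact lt_irrefl _ hlt

/-! ### §2. The increments at the sites of a sub-region are dominated by the sub-region's own chain -/

/-- **Conditioning on a larger past lowers the increments.** For a sub-region `S ⊆ Ω` and an even density
matrix `ρ ∈ 𝔄_Ω`, the sum over the sites `x ∈ S` of the increments `S_ρ(Ω_{≤x}) − S_ρ(Ω_{<x})` of the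
chain of `Ω` is at most the entropy of the restriction of `ρ` to `𝔄_S`:
`Σ_{x∈S} [S_ρ(Ω_{≤x}) − S_ρ(Ω_{<x})] ≤ Σ_{x∈S} [S_ρ(S_{≤x}) − S_ρ(S_{<x})] = S_ρ(S)` — strong subadditivity
(`entropyIncrement_corner_le` with the window `S_{≤x}`) termwise, then the chain rule for the marginal
(`sum_entropyIncrement`). [cite: ArakiMoriya2003, Theorem 3.8 and §10] -/
theorem sum_entropyIncrement_le_regionEntropy {Ω S : Finset (Site d)} (hS : S ⊆ Ω)
    {ρ : FermionOp Ω} (hρ : ρ.PosSemidef) (htr : ρ.trace = 1) (hev : parityAut ρ = ρ) :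
    ∑ x ∈ lexSites S, entropyIncrement ρ x ≤ regionEntropy ρ S := by
  have hρ'h : (fermionPartialTrace (PolySite.incl hS) ρ).IsHermitian :=
    isHermitian_fermionPartialTrace _ hρ.isHermitian
  have hρ'tr : (fermionPartialTrace (PolySite.incl hS) ρ).trace = 1 := by
    rw [trace_fermionPartialTrace, htr]
  rw [regionEntropy_of_subset ρ hS, ← sum_entropyIncrement hρ'h hρ'tr]
  refine Finset.sum_le_sum fun x hx => ?_
  have hy : ofLex x ∈ S := mem_lexSites.1 hx
  have hΛsub : sitesBelowEq S x ⊆ S := Finset.filter_subset _ _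
  have hΛ'sub : sitesBelow S x ⊆ S := Finset.filter_subset _ _
  have hmem : ofLex x ∈ sitesBelowEq S x := mem_sitesBelowEq.2 ⟨hy, (toLex_ofLex x).le⟩
  have hmax : ∀ z ∈ sitesBelowEq S x, toLex z ≤ toLex (ofLex x) := fun z hz => by
    rw [toLex_ofLex]
    exact (mem_sitesBelowEq.1 hz).2
  have hv : shiftSet 0 (sitesBelowEq S x) ⊆ Ω := by
    rw [shiftSet_zero']
    exact hΛsub.trans hS
  have key := entropyIncrement_corner_le hmem hmax hv hρ htr hev
  rw [add_zero, toLex_ofLex, shiftSet_zero', shiftSet_zero'] at key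
  have h1 : (sitesBelowEq S x).erase (ofLex x) = sitesBelow S x := by
    have h := sitesBelowEq_erase S (ofLex x)
    rwa [toLex_ofLex] at h
  rw [h1] at key
  have h2 : entropyIncrement (fermionPartialTrace (PolySite.incl hS) ρ) x =
      regionEntropy ρ (sitesBelowEq S x) - regionEntropy ρ (sitesBelow S x) := by
    rw [entropyIncrement, regionEntropy_fermionPartialTrace hS ρ hΛsub,
      regionEntropy_fermionPartialTrace hS ρ hΛ'sub]
  rw [h2]
  exact key

/-! ### §3. Disjoint boxes: `S(ρ) ≤ Σ_v S_ρ(B_v) + (|Ω| − Σ_v |B_v|)·log 4` -/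

/-- **Box subadditivity for even states.** Let `B_v ⊆ Ω` (`v ∈ V`) be pairwise disjoint sub-regions and
`ρ ∈ 𝔄_Ω` an even density matrix. Then
`S(ρ) ≤ Σ_{v ∈ V} S_ρ(B_v) + (|Ω| − Σ_{v∈V} |B_v|)·log 4`
(chain rule; the increments at the sites of each `B_v` sum to `≤ S_ρ(B_v)` by §2, every other increment is
`≤ log 4`). Iterated subadditivity `S(ρ_{I∪J}) ≤ S(ρ_I) + S(ρ_J)` for even states of the Fermion algebra.
[cite: ArakiMoriya2003, Theorem 3.8 and §10] [cite: NielsenChuang2010, §11.3.4] -/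
theorem vonNeumannEntropy_le_sum_regionEntropy_add {Ω : Finset (Site d)} {ι : Type*} (V : Finset ι)
    (B : ι → Finset (Site d)) (hB : ∀ v ∈ V, B v ⊆ Ω)
    (hdisj : ∀ v ∈ V, ∀ w ∈ V, v ≠ w → Disjoint (B v) (B w))
    {ρ : FermionOp Ω} (hρ : ρ.PosSemidef) (htr : ρ.trace = 1) (hev : parityAut ρ = ρ) :
    vonNeumannEntropy ρ ≤
      ∑ v ∈ V, regionEntropy ρ (B v) + (Ω.card - ∑ v ∈ V, ((B v).card : ℝ)) * Real.log 4 := by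
  classical
  rw [← sum_entropyIncrement hρ.1 htr]
  set C : Finset (Lex (Site d)) := V.biUnion fun v => lexSites (B v) with hC
  have hCsub : C ⊆ lexSites Ω := by
    intro x hx
    obtain ⟨v, hv, hxv⟩ := Finset.mem_biUnion.1 hx
    rw [mem_lexSites] at hxv ⊢
    exact hB v hv hxv
  have hPD : (↑V : Set ι).PairwiseDisjoint fun v => lexSites (B v) := by
    intro v hv w hw hne
    rw [Function.onFun, Finset.disjoint_left]
    intro x hxv hxw
    rw [mem_lexSites] at hxv hxw
    exact Finset.disjoint_left.1 (hdisj v (Finset.mem_coe.1 hv) w (Finset.mem_coe.1 hw) hne) hxv hxw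
  have hCsum : ∑ x ∈ C, entropyIncrement ρ x = ∑ v ∈ V, ∑ x ∈ lexSites (B v), entropyIncrement ρ x :=
    Finset.sum_biUnion hPD
  have hCcard : C.card = ∑ v ∈ V, (B v).card := by
    rw [hC, Finset.card_biUnion hPD]
    refine Finset.sum_congr rfl fun v _ => ?_
    rw [lexSites, Finset.card_map]
  have h1 : ∑ x ∈ C, entropyIncrement ρ x ≤ ∑ v ∈ V, regionEntropy ρ (B v) := by
    rw [hCsum]
    exact Finset.sum_le_sum fun v hv => sum_entropyIncrement_le_regionEntropy (hB v hv) hρ htr hev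
  have h2 : ∑ x ∈ lexSites Ω \ C, entropyIncrement ρ x ≤ (lexSites Ω \ C).card • Real.log 4 :=
    Finset.sum_le_card_nsmul _ _ _ fun x hx =>
      entropyIncrement_le_log_four (mem_lexSites.1 (Finset.mem_sdiff.1 hx).1) hρ htr hev
  have hcard : ((lexSites Ω \ C).card : ℝ) = Ω.card - ∑ v ∈ V, ((B v).card : ℝ) := by
    rw [Finset.card_sdiff_of_subset hCsub, Nat.cast_sub (Finset.card_le_card hCsub), hCcard, lexSites,
      Finset.card_map, Nat.cast_sum]
  rw [← Finset.sum_sdiff hCsub]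
  rw [nsmul_eq_mul, hcard] at h2
  linarith

/-! ### §4. Klein's inequality for a marginal, in big-space form -/

/-- **Klein / Gibbs variational bound for a region entropy.** For `S ⊆ Ω`, a density matrix `ρ ∈ 𝔄_Ω`
and every Hermitian `G ∈ 𝔄_S` (an «entropy witness»):
`S_ρ(S) ≤ Re tr(Γ_{S⊆Ω}(G)·ρ) + log Re Tr e^{−G}` — the Gibbs variational principle
`S(σ) − tr(σG) ≤ log Tr e^{−G}` for the marginal `σ = tr_{Ω∖S} ρ` (no rank condition), with the duality
`tr(G σ) = tr(Γ G · ρ)` moving the witness to the big algebra. With `Tr e^{−G} ≤ 1` the logarithm is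
`≤ 0`. [cite: Israel1979, Lemma II.3.1] -/
theorem regionEntropy_le_re_trace_mul_add_log_partitionFn {Ω S : Finset (Site d)} (hS : S ⊆ Ω)
    {ρ : FermionOp Ω} (hρ : ρ.PosSemidef) (htr : ρ.trace = 1) {G : FermionOp S} (hG : G.IsHermitian) :
    regionEntropy ρ S ≤
      (fermionEmbed (PolySite.incl hS) G * ρ).trace.re + Real.log (partitionFn 1 G).re := by
  rw [regionEntropy_of_subset ρ hS]
  have hρ' : (fermionPartialTrace (PolySite.incl hS) ρ).PosSemidef := posSemidef_fermionPartialTrace _ hρ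
  have htr' : (fermionPartialTrace (PolySite.incl hS) ρ).trace = 1 := by
    rw [trace_fermionPartialTrace, htr]
  have h := hG.vonNeumannEntropy_sub_mul_le_log_partitionFn 1 hρ' htr'
  rw [one_mul, Matrix.trace_mul_comm, trace_mul_fermionPartialTrace] at h
  linarith

/-! ### §5. The linear entropy bound: disjoint boxes with one witness each -/

/-- **Linear entropy bound from box subadditivity and Klein witnesses.** For pairwise disjoint sub-regions
`B_v ⊆ Ω` (`v ∈ V`), Hermitian witnesses `G_v ∈ 𝔄_{B_v}`, and an even density matrix `ρ ∈ 𝔄_Ω`: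
`S(ρ) ≤ Σ_{v∈V} [Re tr(Γ(G_v) ρ) + log Re Tr e^{−G_v}] + (|Ω| − Σ_{v∈V} |B_v|)·log 4`.
Right-hand side LINEAR in `ρ` — with `β E_β − S(ρ_β) = −log Z ≤ β E₀` for a Gibbs state this is the
finite-volume «entropy row» `E_β − T·Σ_v[⟨Γ G_v⟩ + log Tr e^{−G_v}] − T·seam·log 4 ≤ E₀` of the thermal
certificates. [cite: ArakiMoriya2003, Theorem 3.8 and §10] [cite: Israel1979, Lemma II.3.1] -/
theorem vonNeumannEntropy_le_sum_re_trace_add {Ω : Finset (Site d)} {ι : Type*} (V : Finset ι)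
    (B : ι → Finset (Site d)) (hB : ∀ v, B v ⊆ Ω)
    (hdisj : ∀ v ∈ V, ∀ w ∈ V, v ≠ w → Disjoint (B v) (B w))
    {ρ : FermionOp Ω} (hρ : ρ.PosSemidef) (htr : ρ.trace = 1) (hev : parityAut ρ = ρ)
    (G : ∀ v, FermionOp (B v)) (hG : ∀ v, (G v).IsHermitian) :
    vonNeumannEntropy ρ ≤
      ∑ v ∈ V, ((fermionEmbed (PolySite.incl (hB v)) (G v) * ρ).trace.re +
          Real.log (partitionFn 1 (G v)).re) +
        (Ω.card - ∑ v ∈ V, ((B v).card : ℝ)) * Real.log 4 := by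
  have h1 := vonNeumannEntropy_le_sum_regionEntropy_add V B (fun v _ => hB v) hdisj hρ htr hev
  have h2 : ∑ v ∈ V, regionEntropy ρ (B v) ≤
      ∑ v ∈ V, ((fermionEmbed (PolySite.incl (hB v)) (G v) * ρ).trace.re +
        Real.log (partitionFn 1 (G v)).re) :=
    Finset.sum_le_sum fun v _ => regionEntropy_le_re_trace_mul_add_log_partitionFn (hB v) hρ htr (hG v)
  linarith

end Literature.MathematicalPhysics.QuantumLattice

end
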